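import Literature.Analysis.FluidPDE.TsaiTopSingularNullForced
import Literature.Analysis.FluidPDE.ESSLocalHolderHolds
import HarnessLib

/-!
# Escauriaza–Seregin–Šverák's local theorem at the top of a backward cylinder of any size and
  viscosity: `L^∞_t L³_x` implies boundedness up to the top

Analysis/FluidPDE proofs file (no definitions, no named facts). The tree PROVES
Escauriaza–Seregin–Šverák 2003, Thm. 1.4 (`ess_local_holder_holds`, `ESSLocalHolderHolds`): a
distributional solution of the unforced Navier–Stokes system (`ν = 1`) on the unit backward
cylinder `Q₁(0, 0) = (-1, 0) × B₁` in the energy classes, with `p ∈ L^{3/2}(Q₁)` and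
`v ∈ L^∞(-1, 0; L³(B₁))`, is a.e. equal to a Hölder continuous function on the CLOSURE of
`Q_{1/2}(0, 0)` — in particular essentially bounded up to the top `t = 0`. This file records the
consequence used at a putative blow-up time, in Lemarié-Rieusset's §14.3 vocabulary and for every
viscosity and every cylinder (Escauriaza–Seregin–Šverák 2003, §3: "making obvious scaling … we see
that the pair `ṽ` and `p̃` satisfies all conditions of Theorem 1.4"):

* `ess_bounded_near_top_of_L3` — let `ν > 0` and let `(Q_ρ(T, x₀), 0, u, p, G)` lie in
  the §14.3 class with zero force (`IsLRSuitableWeakSolutionOn … ν q 0 u p G`) and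
  `u ∈ L^∞(T - ρ², T; L³(B_ρ(x₀)))`. Then at every point `z = (t, x)` with `T - ρ² < t ≤ T`
  (TOP INCLUDED), `x ∈ B_ρ(x₀)`, `u` is essentially bounded on some backward cylinder `Q_{r₁}(z)`.
  Proof: restrict to a viscous cylinder `Q_ν(z, R) ⊆ Q_ρ(T, x₀)`
  (`IsLRSuitableWeakSolutionOn.of_le_of_isConnected`), rescale to `Q₁(0, 0)` with viscosity `1`
  (`IsLRSuitableWeakSolutionOn.stRescale`; the `L³` bound is scale invariant up to the factor
  `ν⁻³`), apply `ess_local_holder_holds`, bound the Hölder representative on the compact closure of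
  `Q_{1/2}(0, 0)`, transport back.

`-- TODO(general form): ESS's Thm. 1.3 corollary "limsup_{t↑T} ‖v(t)‖_{L³(ℝ³)} = ∞ at a blow-up`
`-- time" for Leray–Hopf solutions is the tree's `ess_endpoint` (smoothness on the open strip);`
`-- the top-of-cylinder boundedness recorded here is the form a maximal classical solution consumes.`

## Mathlib / tree search

Tree (all used): `ess_local_holder_holds` (`ESSLocalHolderHolds`); `IsLRSuitableWeakSolutionOn`,
`.stRescale` (`CKNEpsilonRegularityProofs`); `IsLRSuitableWeakSolutionOn.of_le_of_isConnected`
(`TsaiTopSingularNullForced`); `ae_setLIntegral_slice_le_of_energy` (`CKN1982Setting`);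
`viscousCylinder(Opens)`, `stPreimage_viscousCylinderOpens_self`, `viscousCylinderOpens_one_one_zero`,
`stAffine_preimage_viscousCylinder`, `exists_nnreal_of_ae_le` (`NSSuitableESS`);
`parabolicCylinder_subset_viscousCylinder`, `le_sq_of_le_of_one_le` (`TsaiLocalEnergyProofs`);
`ae_sliced_setLIntegral_ball_stRescale`, `ae_restrict_of_ae_restrict_preimage_stAffine`,
`smul_stPull_apply` (`SpaceTimeRescaling`); `closure_parabolicCylinder_subset`. Mathlib:
`HolderOnWith.continuousOn`, `IsCompact.exists_bound_of_continuousOn`.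

## References

* L. Escauriaza, G. Seregin, V. Šverák, *`L_{3,∞}`-solutions of Navier–Stokes equations and
  backward uniqueness*, Russ. Math. Surveys 58 (2003) 211–250: Thm. 1.4, §3 (scaling, (3.5)–(3.7)),
  Thm. 1.3. [EscauriazaSereginSverak2003]
* G. Seregin, *Lecture notes on regularity theory for the Navier–Stokes equations*, World
  Scientific (2014), Thm. 6.?? (the local `L_{3,∞}` theorem). [Seregin2014]
-/

noncomputable section

open MeasureTheory Set Function Filter Topology TopologicalSpace Metric
open scoped NNReal ENNReal InnerProductSpace RealInnerProductSpace

namespace Literature.Analysis.FluidPDE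

/-- Viscous cylinders of positive radius are connected. [folklore] -/
private theorem isConnected_viscousCylinder' {ν R : ℝ} (hν : 0 < ν) (hR : 0 < R)
    (z : ℝ × EuclideanSpace ℝ (Fin 3)) : IsConnected (viscousCylinder ν R z) := by
  refine ⟨⟨(z.1 - R ^ 2 / ν / 2, z.2), ?_⟩, ?_⟩
  · rw [mem_viscousCylinder, dist_self]
    have : 0 < R ^ 2 / ν := by positivity
    exact ⟨⟨by linarith, by linarith⟩, hR⟩
  · rw [viscousCylinder]
    exact ((convex_Ioo _ _).prod (convex_ball _ _)).isPreconnected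

/-- The closure of a backward parabolic cylinder is compact. [folklore] -/
private theorem isCompact_closure_parabolicCylinder' (r : ℝ) (z : ℝ × EuclideanSpace ℝ (Fin 3)) :
    IsCompact (closure (parabolicCylinder r z)) :=
  (isCompact_Icc.prod (isCompact_closedBall _ _)).of_isClosed_subset isClosed_closure
    (closure_parabolicCylinder_subset r z)

/-- **Escauriaza–Seregin–Šverák's local theorem at the top of a backward cylinder, every
viscosity and size** (ESS 2003, Thm. 1.4 with the scaling of §3). Let `ν > 0`, `ρ > 0`, and let
`(Q_ρ(T, x₀), 0, u, p, G)` lie in Lemarié-Rieusset's §14.3 class with zero force (any force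
exponent `q`; any radius `ρ`): `u ∈ L^∞_t L²_x`, `G = ∇u` with `∫∫ |G|² < ∞`, `p ∈ L^{3/2}`, the equations in `𝒟'`,
the local energy inequality. If moreover `u ∈ L^∞(T - ρ², T; L³(B_ρ(x₀)))`, then at every point
`z = (t, x)` with `T - ρ² < t ≤ T` (the top `t = T` included) and `x ∈ B_ρ(x₀)`, `u` is essentially
bounded on some backward cylinder `Q_{r₁}(z)`, `r₁ > 0`. [cite: EscauriazaSereginSverak2003, Thm. 1.4 and §3 (scaling)] -/
theorem ess_bounded_near_top_of_L3 {ν ρ T q : ℝ} {x₀ : EuclideanSpace ℝ (Fin 3)}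
    (hν : 0 < ν)
    {u : ℝ → EuclideanSpace ℝ (Fin 3) → EuclideanSpace ℝ (Fin 3)}
    {p : ℝ → EuclideanSpace ℝ (Fin 3) → ℝ}
    {G : ℝ → EuclideanSpace ℝ (Fin 3) → EuclideanSpace ℝ (Fin 3) →L[ℝ] EuclideanSpace ℝ (Fin 3)}
    (hS : IsLRSuitableWeakSolutionOn (parabolicCylinderOpens ρ (T, x₀)) ν q 0 u p G)
    (hL3 : ∃ C : ℝ≥0, ∀ᵐ t ∂(volume.restrict (Ioo (T - ρ ^ 2) T)),
      ∫⁻ x in ball x₀ ρ, ‖u t x‖ₑ ^ 3 ≤ C) :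
    ∀ z : ℝ × EuclideanSpace ℝ (Fin 3), z.1 ∈ Ioc (T - ρ ^ 2) T → z.2 ∈ ball x₀ ρ →
      ∃ r₁ : ℝ, 0 < r₁ ∧
        eLpNorm (uncurry u) ⊤ (volume.restrict (parabolicCylinder r₁ z)) < ⊤ := by
  intro z hzt hzx
  obtain ⟨t, x⟩ := z
  dsimp only at hzt hzx ⊢
  obtain ⟨C₃, hC₃⟩ := hL3
  have hC₃' : ∀ᵐ s : ℝ, s ∈ Ioo (T - ρ ^ 2) T → ∫⁻ y in ball x₀ ρ, ‖u s y‖ₑ ^ 3 ≤ C₃ :=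
    (ae_restrict_iff' measurableSet_Ioo).1 hC₃
  -- the inflation factor `m' = max 1 ν`
  set m' : ℝ := max 1 ν with hm'
  have hm'1 : 1 ≤ m' := le_max_left _ _
  have hm'0 : 0 < m' := one_pos.trans_le hm'1
  have hm'ν : ν ≤ m' ^ 2 := le_sq_of_le_of_one_le (le_max_right _ _) hm'1
  -- ## a viscous cylinder `Q_ν((t, x), R)` inside `Q_ρ(T, x₀)`
  have hgt : 0 < t - (T - ρ ^ 2) := sub_pos.2 hzt.1
  have hgx : 0 < ρ - dist x x₀ := sub_pos.2 (mem_ball.1 hzx)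
  obtain ⟨R, hR, hRt, hRx⟩ : ∃ R : ℝ, 0 < R ∧ R ^ 2 / ν < t - (T - ρ ^ 2) ∧ R < ρ - dist x x₀ := by
    refine ⟨min ((ρ - dist x x₀) / 2) (min 1 (ν * (t - (T - ρ ^ 2)) / 2)), by positivity, ?_, ?_⟩
    · set R := min ((ρ - dist x x₀) / 2) (min 1 (ν * (t - (T - ρ ^ 2)) / 2)) with hRdef
      have hR0 : 0 ≤ R := by positivity
      have hR1 : R ≤ 1 := (min_le_right _ _).trans (min_le_left _ _)
      have hR2 : R ≤ ν * (t - (T - ρ ^ 2)) / 2 := (min_le_right _ _).trans (min_le_right _ _)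
      rw [div_lt_iff₀ hν]
      calc R ^ 2 = R * R := sq R
        _ ≤ 1 * (ν * (t - (T - ρ ^ 2)) / 2) := mul_le_mul hR1 hR2 hR0 zero_le_one
        _ < (t - (T - ρ ^ 2)) * ν := by nlinarith [mul_pos hν hgt]
    · exact (min_le_left _ _).trans_lt (by linarith)
  have hVQ : viscousCylinder ν R (t, x) ⊆ parabolicCylinder ρ (T, x₀) := by
    intro w hw
    rw [mem_viscousCylinder] at hw
    rw [mem_parabolicCylinder]
    obtain ⟨⟨h1, h2⟩, h3⟩ := hw
    dsimp only at h1 h2 h3 ⊢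
    refine ⟨⟨by linarith, by linarith [hzt.2]⟩, ?_⟩
    calc dist w.2 x₀ ≤ dist w.2 x + dist x x₀ := dist_triangle _ _ _
      _ < ρ := by linarith
  have hVQ' : viscousCylinderOpens ν R (t, x) ≤ parabolicCylinderOpens ρ (T, x₀) := hVQ
  have hSV : IsLRSuitableWeakSolutionOn (viscousCylinderOpens ν R (t, x)) ν q 0 u p G :=
    hS.of_le_of_isConnected hVQ' (isConnected_viscousCylinder' hν hR _)
  -- the `L³` bound on the slices of the viscous cylinder
  have hC₃V : ∀ᵐ s ∂(volume.restrict (Ioo (t + R ^ 2 / ν * (-1)) (t + R ^ 2 / ν * 0))),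
      ∫⁻ y in ball x R, ‖u s y‖ₑ ^ 3 ≤ C₃ := by
    have hI : Ioo (t + R ^ 2 / ν * (-1)) (t + R ^ 2 / ν * 0) = Ioo (t - R ^ 2 / ν) t := by
      congr 1 <;> ring
    rw [hI, ae_restrict_iff' measurableSet_Ioo]
    filter_upwards [hC₃'] with s hs hsI
    have hsI' : s ∈ Ioo (T - ρ ^ 2) T := ⟨by linarith [hsI.1], by linarith [hsI.2, hzt.2]⟩
    exact (lintegral_mono_set (ball_subset_ball' (by linarith))).trans (hs hsI')
  -- ## the rescaled datum on the unit cylinder, viscosity `1`, force `0`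
  have hα : 0 < R / ν := by positivity
  have hβ : 0 < R ^ 2 / ν := by positivity
  have hβ' : R ^ 2 / ν = R / ν * R := by ring
  set z₀ : ℝ × EuclideanSpace ℝ (Fin 3) := ((0 : ℝ), (0 : EuclideanSpace ℝ (Fin 3))) with hz₀
  set u₁ : ℝ → EuclideanSpace ℝ (Fin 3) → EuclideanSpace ℝ (Fin 3) :=
    (R / ν) • stPull (R ^ 2 / ν) R t x u with hu₁
  set p₁ : ℝ → EuclideanSpace ℝ (Fin 3) → ℝ := (R / ν) ^ 2 • stPull (R ^ 2 / ν) R t x p with hp₁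
  set G₁ : ℝ → EuclideanSpace ℝ (Fin 3) → EuclideanSpace ℝ (Fin 3) →L[ℝ] EuclideanSpace ℝ (Fin 3) :=
    (R / ν * R) • stPull (R ^ 2 / ν) R t x G with hG₁
  have h1 : IsLRSuitableWeakSolutionOn (parabolicCylinderOpens 1 z₀) 1 q 0 u₁ p₁ G₁ := by
    have h := hSV.stRescale hα hR hβ' t x
    have e1 : R / ν * ν / R = 1 := by field_simp
    have e2 : ((R / ν) ^ 2 * R) • stPull (R ^ 2 / ν) R t x
        (0 : ℝ → EuclideanSpace ℝ (Fin 3) → EuclideanSpace ℝ (Fin 3)) = 0 := by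
      funext s y; simp [stPull]
    rw [e1, e2, stPreimage_viscousCylinderOpens_self hν hR, viscousCylinderOpens_one_one_zero] at h
    exact h
  have hQ₁ : parabolicCylinder 1 z₀ = Ioo (-1 : ℝ) 0 ×ˢ ball (0 : EuclideanSpace ℝ (Fin 3)) 1 := by
    rw [hz₀, parabolicCylinder]
    norm_num
  -- (b) the energy class in sliced form
  have henergy : ∃ C : ℝ≥0, ∀ᵐ s ∂(volume.restrict (Ioo (-1 : ℝ) 0)),
      ∫⁻ y in ball (0 : EuclideanSpace ℝ (Fin 3)) 1, ‖u₁ s y‖ₑ ^ 2 ≤ C := by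
    obtain ⟨CE, hCE⟩ := h1.energyClass
    refine ⟨CE, (ae_restrict_iff' measurableSet_Ioo).2 ?_⟩
    refine ae_setLIntegral_slice_le_of_energy hCE measurableSet_ball ?_
    rw [← hQ₁]
    exact Subset.rfl
  -- (e) the `L³` class in sliced form: `∫_{B₁} |u₁(s)|³ = (R/ν)³ R⁻³ ∫_{B_R(x)} |u|³ ≤ ν⁻³ C₃`
  have hL3' : ∃ C : ℝ≥0, ∀ᵐ s ∂(volume.restrict (Ioo (-1 : ℝ) 0)),
      ∫⁻ y in ball (0 : EuclideanSpace ℝ (Fin 3)) 1, ‖u₁ s y‖ₑ ^ 3 ≤ C := by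
    have h := ae_sliced_setLIntegral_ball_stRescale hβ hR t x x R (-1) 0
      (fun s y => ‖u s y‖ₑ ^ 3) hC₃V
    have hball : ball (R⁻¹ • (x - x)) (R / R) = ball (0 : EuclideanSpace ℝ (Fin 3)) 1 := by
      rw [sub_self, smul_zero, div_self hR.ne']
    rw [hball] at h
    obtain ⟨C', hC'⟩ := exists_nnreal_of_ae_le
      (K := ‖R / ν‖ₑ ^ 3 * (ENNReal.ofReal (R ^ Module.finrank ℝ (EuclideanSpace ℝ (Fin 3)))⁻¹ * C₃))
      (ENNReal.mul_ne_top (by simp) (ENNReal.mul_ne_top ENNReal.ofReal_ne_top ENNReal.coe_ne_top))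
      (μ := volume.restrict (Ioo (-1 : ℝ) 0))
      (f := fun s => ∫⁻ y in ball (0 : EuclideanSpace ℝ (Fin 3)) 1, ‖u₁ s y‖ₑ ^ 3)
      (by
        filter_upwards [h] with s hs
        have e : ∀ y : EuclideanSpace ℝ (Fin 3), ‖u₁ s y‖ₑ ^ 3 =
            ‖R / ν‖ₑ ^ 3 * ‖u (t + R ^ 2 / ν * s) (x + R • y)‖ₑ ^ 3 := by
          intro y
          rw [hu₁, smul_stPull_apply, enorm_smul, mul_pow]
        simp_rw [e]
        rw [lintegral_const_mul' _ _ (by simp)]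
        exact mul_le_mul_right hs _)
    exact ⟨C', hC'⟩
  -- ## ESS Thm. 1.4 on the unit cylinder
  have hdist : IsDistributionalNSSolutionOn (parabolicCylinderOpens 1 z₀) 1 0 u₁ p₁ := h1.distributional
  obtain ⟨w, Cw, α, hα0, hHolder, hae⟩ := ess_local_holder_holds u₁ p₁ hdist henergy
    ⟨G₁, h1.weakGradient, h1.gradient_lt_top⟩ h1.pressure_lt_top hL3'
  -- the Hölder representative is bounded on the compact closure of `Q_{1/2}(0, 0)`
  obtain ⟨M, hM⟩ := (isCompact_closure_parabolicCylinder' (1 / 2) z₀).exists_bound_of_continuousOn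
    (hHolder.continuousOn hα0)
  have hbd : ∀ᵐ z ∂(volume.restrict (parabolicCylinder (1 / 2) z₀)), ‖uncurry u₁ z‖ ≤ M := by
    filter_upwards [hae, ae_restrict_mem (isOpen_parabolicCylinder _ _).measurableSet] with z hz hzQ
    rw [hz]
    exact hM z (subset_closure hzQ)
  -- ## transport back: `u` is bounded by `M ν / R` on `Q_{R/(2 m')}(t, x)`
  have hpre : parabolicCylinder (1 / 2) z₀ =
      stAffine (R ^ 2 / ν) R t x ⁻¹' viscousCylinder ν (R * (1 / 2)) (t, x) := by
    rw [hz₀, stAffine_preimage_viscousCylinder hν hR, mul_div_cancel_left₀ _ hR.ne']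
  have hbd' : ∀ᵐ z ∂(volume.restrict (parabolicCylinder (1 / 2) z₀)),
      ‖(R / ν) • u (stAffine (R ^ 2 / ν) R t x z).1 (stAffine (R ^ 2 / ν) R t x z).2‖ ≤ M := by
    filter_upwards [hbd] with z hz
    exact hz
  rw [hpre] at hbd'
  have h8 := ae_restrict_of_ae_restrict_preimage_stAffine hβ hR t x
    (P := fun z => ‖(R / ν) • u z.1 z.2‖ ≤ M) hbd'
  have hsub : parabolicCylinder (R * (1 / 2) / m') (t, x) ⊆ viscousCylinder ν (R * (1 / 2)) (t, x) :=
    parabolicCylinder_subset_viscousCylinder hν hm'1 hm'ν (by positivity) _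
  refine ⟨R * (1 / 2) / m', by positivity, ?_⟩
  rw [eLpNorm_exponent_top]
  refine eLpNormEssSup_lt_top_of_ae_bound (C := M / (R / ν)) ?_
  filter_upwards [ae_restrict_of_ae_restrict_of_subset hsub h8] with z hz
  rw [norm_smul, Real.norm_eq_abs, abs_of_pos hα] at hz
  rw [le_div_iff₀ hα, mul_comm]
  exact hz

end Literature.Analysis.FluidPDE

end
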